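import Mathlib
import Literature.MathematicalPhysics.QuantumLattice.HubbardBandSectorCountingToolbox
import Summits.HubbardSuperconductivity.HubbardSuperconductivity.Theorems.KLProgrammeKLRegimeTwoPointLimitShellAngularTransversal
import HarnessLib

/-!
# Route `KLProgramme` — crux K3 `KLRegimeTwoPointLimit` (stmt-HubbardSuperconductivity-19937), support:
# Lemma E.1 in the Cooper regime with explicit constants (DECOMP App. E; the freezing input of E.4)

Cell `gate-hubbard-kl`, seat p1b; paper note `HOME/prover-p1b/E1-NOTE.md` §3–§4.

`klsa_volume_sublevel_le_cooper` bounds the angular sublevel set of the translated band Fermi curve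
by `5 δ/λ` given abstract slope data `(η, λ, r₀, r₂)`. This file INSTANTIATES the data for a small
transfer `w`: `r₀ = |w|_∞` (the torus sup-distance to the Cooper point `2πℤ²` when `|w|_∞ ≤ π`),
`r₂ = κ₃ - |w|_∞` with `κ₃ = min(√2 u_min, 2π - 2K(μ))` (the sup-distance to the caustic
`2F_μ + 2πℤ²`), `λ = |w|_∞/(4 s_max C_g)`, `s = |w|₂/ρ_min`, `η = (√2π/ρ_min + 1)|w|₂² + δ`, and checks
the four inequalities of `klst_slope_lower_bound`. Result (`klse_volume_sublevel_le_cooper_explicit`):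
for `|w|` below explicit thresholds in the fields of `BandBounds` and `δ ≲ |w|_∞`,

  `|{θ ∈ [θ₀, θ₀ + 2π] : |ε(p_μ(θ) - w) - μ| ≤ δ}| ≤ 5 · 4 s_max C_g · δ / |w|_∞`,

the sharp linear law of Lemma E.1 at the Cooper point with the constant `20 s_max C_g`
(`C_g = π c_max/(2 a_min ρ_min²)` carries the curvature through the Gauss-map rate `a_min`). Combined
with the tube reduction `klta_volume_twoShell_le` (`δ = ε₂ + 4Lε₁`) this is the two-shell area bound
`Area ≤ 16 L ε₁ · 20 s_max C_g (ε₂ + 4Lε₁)/|w|_∞` that makes the particle–particle increments summable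
below the transfer scale.
-/

noncomputable section

-- the tree's namespace `Summit.<Summit>.<Problem>.Theorems` repeats the summit name by design (D-0017)
set_option linter.dupNamespace false

open Real Set MeasureTheory
open scoped ENNReal
open Literature.MathematicalPhysics.QuantumLattice
open Literature.MathematicalPhysics.QuantumLattice.BandSectorCounting

namespace Summit.HubbardSuperconductivity.HubbardSuperconductivity.Theorems

section Main

variable {a b : ℝ} (B : BandBounds a b) {μ : ℝ} (hμ : μ ∈ Icc a b)
include B hμ

omit B hμ in
/-- The sup-norm `|w|_∞ ≤ π` of a transfer in the cell bounds its torus sup-distance to `2πℤ²`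
from below: `|w|_∞ ≤ max(|w₁ - 2πm₀|, |w₂ - 2πm₁|)` for all integers `m₀, m₁`. -/
theorem klse_supnorm_le_latticeDist {w₁ w₂ : ℝ} (hπ' : max |w₁| |w₂| ≤ π) (m₀ m₁ : ℤ) :
    max |w₁| |w₂| ≤ max |w₁ - m₀ * (2 * π)| |w₂ - m₁ * (2 * π)| := by
  have hπ := Real.pi_pos
  have key : ∀ (x : ℝ) (m : ℤ), m ≠ 0 → 2 * π - |x| ≤ |x - m * (2 * π)| := by
    intro x m hm
    have h1 : (1 : ℝ) ≤ |(m : ℝ)| := by exact_mod_cast Int.one_le_abs hm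
    have h2 : |(m : ℝ) * (2 * π)| ≥ 2 * π := by
      rw [abs_mul, abs_of_pos (by positivity : (0:ℝ) < 2 * π)]; nlinarith
    have h3 := abs_sub_abs_le_abs_sub ((m : ℝ) * (2 * π)) x
    rw [abs_sub_comm] at h3
    linarith
  by_cases h0 : m₀ = 0
  · by_cases h1 : m₁ = 0
    · subst h0; subst h1; simp
    · have := key w₂ m₁ h1
      have hw1 : |w₁| ≤ π := (le_max_left _ _).trans hπ'
      have hw2 : |w₂| ≤ π := (le_max_right _ _).trans hπ'
      calc max |w₁| |w₂| ≤ π := hπ'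
        _ ≤ |w₂ - m₁ * (2 * π)| := by linarith
        _ ≤ _ := le_max_right _ _
  · have := key w₁ m₀ h0
    have hw1 : |w₁| ≤ π := (le_max_left _ _).trans hπ'
    calc max |w₁| |w₂| ≤ π := hπ'
      _ ≤ |w₁ - m₀ * (2 * π)| := by linarith
      _ ≤ _ := le_max_left _ _

/-- The sup-distance of a small transfer to the caustic `2F_μ + 2πℤ²` is at least
`min(√2 u_min, 2π - 2K(μ)) - |w|_∞`: `|2p_μ(ψ)|_∞ ≥ √2 u_min` and the nonzero translates are
`≥ 2π - 2K(μ)` away in sup-norm (`|X|, |Y| ≤ K(μ)`). -/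
theorem klse_causticDist_lower {w₁ w₂ : ℝ} (m₀ m₁ : ℤ) (ψ : ℝ) :
    min (Real.sqrt 2 * B.umin) (2 * π - 2 * umklappRadius μ) - max |w₁| |w₂| ≤
      max |w₁ - m₀ * (2 * π) - 2 * bandX μ ψ| |w₂ - m₁ * (2 * π) - 2 * bandY μ ψ| := by
  obtain ⟨h1, h2⟩ := B.level hμ
  have hπ := Real.pi_pos
  have hKX := abs_bandX_le_umklappRadius h1 h2 ψ
  have hKY := abs_bandY_le_umklappRadius h1 h2 ψ
  have hw1 : |w₁| ≤ max |w₁| |w₂| := le_max_left _ _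
  have hw2 : |w₂| ≤ max |w₁| |w₂| := le_max_right _ _
  -- `max(|X|, |Y|) ≥ (√2/2) u ≥ (√2/2) u_min`
  have hbig : Real.sqrt 2 * B.umin ≤ max |2 * bandX μ ψ| |2 * bandY μ ψ| := by
    have hu := B.umin_le μ hμ ψ
    have hupos := bandFermiRadius_pos h1 h2 ψ
    have hd := sqrt_two_div_two_le_norm_dir ψ
    rw [norm_dir] at hd
    have hX : |2 * bandX μ ψ| = 2 * bandFermiRadius μ ψ * |Real.cos ψ| := by
      rw [bandX, abs_mul, abs_mul, abs_two, abs_of_pos hupos]; ring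
    have hY : |2 * bandY μ ψ| = 2 * bandFermiRadius μ ψ * |Real.sin ψ| := by
      rw [bandY, abs_mul, abs_mul, abs_two, abs_of_pos hupos]; ring
    rw [hX, hY]
    rcases le_max_iff.1 hd with hc | hs
    · have hm := mul_le_mul hu hc (by positivity) hupos.le
      calc Real.sqrt 2 * B.umin = 2 * (B.umin * (Real.sqrt 2 / 2)) := by ring
        _ ≤ 2 * (bandFermiRadius μ ψ * |Real.cos ψ|) := by linarith
        _ = 2 * bandFermiRadius μ ψ * |Real.cos ψ| := by ring
        _ ≤ _ := le_max_left _ _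
    · have hm := mul_le_mul hu hs (by positivity) hupos.le
      calc Real.sqrt 2 * B.umin = 2 * (B.umin * (Real.sqrt 2 / 2)) := by ring
        _ ≤ 2 * (bandFermiRadius μ ψ * |Real.sin ψ|) := by linarith
        _ = 2 * bandFermiRadius μ ψ * |Real.sin ψ| := by ring
        _ ≤ _ := le_max_right _ _
  have key : ∀ (x X : ℝ) (m : ℤ), m ≠ 0 → |X| ≤ umklappRadius μ →
      2 * π - 2 * umklappRadius μ - |x| ≤ |x - m * (2 * π) - 2 * X| := by
    intro x X m hm hX
    have h1' : (1 : ℝ) ≤ |(m : ℝ)| := by exact_mod_cast Int.one_le_abs hm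
    have h2' : |(m : ℝ) * (2 * π)| ≥ 2 * π := by
      rw [abs_mul, abs_of_pos (by positivity : (0:ℝ) < 2 * π)]; nlinarith
    have e : x - m * (2 * π) - 2 * X = -( (m : ℝ) * (2 * π) - (x - 2 * X)) := by ring
    rw [e, abs_neg]
    have h3 := abs_sub_abs_le_abs_sub ((m : ℝ) * (2 * π)) (x - 2 * X)
    have h4 : |x - 2 * X| ≤ |x| + 2 * |X| := by
      calc |x - 2 * X| ≤ |x| + |2 * X| := abs_sub _ _
        _ = |x| + 2 * |X| := by rw [abs_mul, abs_two]
    linarith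
  by_cases h0 : m₀ = 0
  · by_cases h1' : m₁ = 0
    · subst h0; subst h1'
      simp only [Int.cast_zero, zero_mul, sub_zero]
      -- `max|wᵢ - 2pᵢ| ≥ max|2pᵢ| - |w|_∞`
      have e1 : |2 * bandX μ ψ| ≤ |w₁ - 2 * bandX μ ψ| + |w₁| := by
        have := abs_sub_abs_le_abs_sub (2 * bandX μ ψ) w₁; rw [abs_sub_comm] at this; linarith
      have e2 : |2 * bandY μ ψ| ≤ |w₂ - 2 * bandY μ ψ| + |w₂| := by
        have := abs_sub_abs_le_abs_sub (2 * bandY μ ψ) w₂; rw [abs_sub_comm] at this; linarith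
      have hm := min_le_left (Real.sqrt 2 * B.umin) (2 * π - 2 * umklappRadius μ)
      rcases le_max_iff.1 hbig with hx | hy
      · calc _ ≤ |w₁ - 2 * bandX μ ψ| := by linarith
          _ ≤ _ := le_max_left _ _
      · calc _ ≤ |w₂ - 2 * bandY μ ψ| := by linarith
          _ ≤ _ := le_max_right _ _
    · have := key w₂ (bandY μ ψ) m₁ h1' hKY
      have hm := min_le_right (Real.sqrt 2 * B.umin) (2 * π - 2 * umklappRadius μ)
      calc _ ≤ |w₂ - m₁ * (2 * π) - 2 * bandY μ ψ| := by linarith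
        _ ≤ _ := le_max_right _ _
  · have := key w₁ (bandX μ ψ) m₀ h0 hKX
    have hm := min_le_right (Real.sqrt 2 * B.umin) (2 * π - 2 * umklappRadius μ)
    calc _ ≤ |w₁ - m₀ * (2 * π) - 2 * bandX μ ψ| := by linarith
      _ ≤ _ := le_max_left _ _

/-- **Lemma E.1 at the Cooper point, explicit constants.** Let `μ` lie in the level range with
margin `η⋆`, and let `w ≠ 0` be a small transfer: `|w|₂ < ρ_min`, `|w|_∞ ≤ π`,
`|w|_∞ ≤ κ₃/4` (`κ₃ = min(√2 u_min, 2π - 2K(μ))`, the separation of the Cooper point from the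
caustic), and, with `η := (√2π/ρ_min + 1)|w|₂² + δ` and `κ₂ := (2 s_max² C_g + 1)/Dt_min`:
`η ≤ η⋆`, `κ₂ η ≤ |w|_∞/2`, `(A₂/4)(3|w|_∞/(4 s_max))² + |w|_∞/2 < κ₃/2` (all hold for `|w|_∞` below
a threshold depending only on `B` and `δ ≤ |w|_∞/(4κ₂)`). Then the angular sublevel set of the
translated level function on any period has measure `≤ 5·δ/λ` with `λ = |w|_∞/(4 s_max C_g)`,
i.e. `≤ 20 s_max C_g · δ/|w|_∞`. -/
theorem klse_volume_sublevel_le_cooper_explicit {ηs δ w₁ w₂ θ₀ : ℝ}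
    (hlo : a ≤ μ - ηs) (hhi : μ + ηs ≤ b)
    (hw : 0 < Real.sqrt (w₁ ^ 2 + w₂ ^ 2)) (hr1 : Real.sqrt (w₁ ^ 2 + w₂ ^ 2) < B.rhomin)
    (hr2 : max |w₁| |w₂| ≤ π)
    (hr3 : max |w₁| |w₂| ≤ min (Real.sqrt 2 * B.umin) (2 * π - 2 * umklappRadius μ) / 4)
    (hδ : 0 ≤ δ)
    (hη1 : (Real.sqrt 2 * π / B.rhomin + 1) * (w₁ ^ 2 + w₂ ^ 2) + δ ≤ ηs)
    (hη2 : (2 * B.smax ^ 2 * B.Cg + 1) / B.Dtmin * ((Real.sqrt 2 * π / B.rhomin + 1) * (w₁ ^ 2 + w₂ ^ 2) + δ)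
      ≤ max |w₁| |w₂| / 2)
    (hη3 : B.A2 / 4 * (3 * max |w₁| |w₂| / (4 * B.smax)) ^ 2 + max |w₁| |w₂| / 2 <
      min (Real.sqrt 2 * B.umin) (2 * π - 2 * umklappRadius μ) / 2) :
    volume {θ ∈ Icc θ₀ (θ₀ + 2 * π) | |eps2 (bandX μ θ - w₁) (bandY μ θ - w₂) - μ| ≤ δ} ≤
      5 * ENNReal.ofReal (δ / (max |w₁| |w₂| / (4 * B.smax * B.Cg))) := by
  have hπ := Real.pi_pos
  have hs := B.smax_pos
  have hC := B.Cg_pos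
  have hD := B.Dtmin_pos
  have hρ := B.rhomin_pos
  have hA := B.A2_pos
  set r := Real.sqrt (w₁ ^ 2 + w₂ ^ 2) with hr
  set rinf := max |w₁| |w₂| with hrinf
  set κ₁ := Real.sqrt 2 * π / B.rhomin + 1 with hκ₁
  set κ₂ := (2 * B.smax ^ 2 * B.Cg + 1) / B.Dtmin with hκ₂
  set κ₃ := min (Real.sqrt 2 * B.umin) (2 * π - 2 * umklappRadius μ) with hκ₃
  set η := κ₁ * (w₁ ^ 2 + w₂ ^ 2) + δ with hη
  set lam := rinf / (4 * B.smax * B.Cg) with hlam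
  have hr2sq : r ^ 2 = w₁ ^ 2 + w₂ ^ 2 := Real.sq_sqrt (by positivity)
  -- `rinf > 0`
  have hrinf0 : 0 < rinf := by
    by_contra hle
    push Not at hle
    have h1 : |w₁| ≤ 0 := (le_max_left _ _).trans hle
    have h2 : |w₂| ≤ 0 := (le_max_right _ _).trans hle
    have hw1 : w₁ = 0 := abs_nonpos_iff.1 h1
    have hw2 : w₂ = 0 := abs_nonpos_iff.1 h2
    have : r = 0 := by rw [hr, hw1, hw2]; simp
    linarith
  have hlam0 : 0 < lam := by positivity
  have hκ₁0 : 0 < κ₁ := by positivity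
  have hη0 : δ ≤ η := by
    have h0 : 0 ≤ κ₁ * (w₁ ^ 2 + w₂ ^ 2) := by positivity
    rw [hη]; linarith
  have hηs : η ≤ ηs := hη1
  have hκ₂η : κ₂ * η ≤ rinf / 2 := hη2
  have hκ₂ge : 1 / B.Dtmin ≤ κ₂ := by
    rw [hκ₂]; apply div_le_div_of_nonneg_right _ hD.le; nlinarith
  have hηpos : 0 ≤ η := hδ.trans hη0
  have hηD : η / B.Dtmin ≤ rinf / 2 := by
    calc η / B.Dtmin = 1 / B.Dtmin * η := by ring
      _ ≤ κ₂ * η := mul_le_mul_of_nonneg_right hκ₂ge hηpos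
      _ ≤ rinf / 2 := hκ₂η
  -- the inner expression `C_g(λ + 2 s_max η/Dt_min) ≤ 3 rinf/(4 s_max)`
  have hCgl : B.Cg * lam = rinf / (4 * B.smax) := by rw [hlam]; field_simp
  have hmid : B.Cg * (2 * B.smax * (η / B.Dtmin)) ≤ rinf / (2 * B.smax) := by
    -- `s_max · (this) = (2 s_max² C_g/Dt_min) η ≤ κ₂ η ≤ rinf/2`
    have h1 : B.smax * (B.Cg * (2 * B.smax * (η / B.Dtmin))) = (2 * B.smax ^ 2 * B.Cg) / B.Dtmin * η := by
      field_simp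
    have h2 : (2 * B.smax ^ 2 * B.Cg) / B.Dtmin ≤ κ₂ := by
      rw [hκ₂]; apply div_le_div_of_nonneg_right _ hD.le; linarith
    have h3 : B.smax * (B.Cg * (2 * B.smax * (η / B.Dtmin))) ≤ rinf / 2 := by
      rw [h1]; exact (mul_le_mul_of_nonneg_right h2 hηpos).trans hκ₂η
    rw [le_div_iff₀ (by positivity)]
    nlinarith
  have hinner : B.Cg * (lam + 2 * B.smax * (η / B.Dtmin)) ≤ 3 * rinf / (4 * B.smax) := by
    rw [mul_add, hCgl]
    have : rinf / (4 * B.smax) + rinf / (2 * B.smax) = 3 * rinf / (4 * B.smax) := by field_simp; ring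
    linarith
  have hinner0 : 0 ≤ B.Cg * (lam + 2 * B.smax * (η / B.Dtmin)) := by positivity
  -- the four slope conditions
  have h₀ : B.smax * (B.Cg * (lam + 2 * B.smax * (η / B.Dtmin))) + η / B.Dtmin < rinf := by
    have e0 : B.smax * (B.Cg * (lam + 2 * B.smax * (η / B.Dtmin))) + η / B.Dtmin =
        rinf / 4 + κ₂ * η := by
      rw [hκ₂, hlam]; field_simp; ring
    rw [e0]; linarith
  have h₂ : B.A2 / 4 * (B.Cg * (lam + 2 * B.smax * (η / B.Dtmin))) ^ 2 + η / B.Dtmin < κ₃ - rinf := by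
    have hsq : (B.Cg * (lam + 2 * B.smax * (η / B.Dtmin))) ^ 2 ≤ (3 * rinf / (4 * B.smax)) ^ 2 :=
      pow_le_pow_left₀ hinner0 hinner 2
    have h1 : B.A2 / 4 * (B.Cg * (lam + 2 * B.smax * (η / B.Dtmin))) ^ 2 ≤
        B.A2 / 4 * (3 * rinf / (4 * B.smax)) ^ 2 := mul_le_mul_of_nonneg_left hsq (by positivity)
    have hr3' : rinf ≤ κ₃ / 4 := hr3
    linarith [hη3]
  -- distances
  have hr₀ : ∀ m₀ m₁ : ℤ, rinf ≤ max |w₁ - m₀ * (2 * π)| |w₂ - m₁ * (2 * π)| :=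
    fun m₀ m₁ => klse_supnorm_le_latticeDist hr2 m₀ m₁
  have hr₂ : ∀ (m₀ m₁ : ℤ) (ψ : ℝ),
      κ₃ - rinf ≤ max |w₁ - m₀ * (2 * π) - 2 * bandX μ ψ| |w₂ - m₁ * (2 * π) - 2 * bandY μ ψ| :=
    fun m₀ m₁ ψ => klse_causticDist_lower B hμ m₀ m₁ ψ
  -- the Gauss-map arc data: `s = r/ρ_min`
  set s := r / B.rhomin with hsdef
  have hs0 : 0 ≤ s := by positivity
  have hs1 : s < 1 := by rw [hsdef, div_lt_one hρ]; exact hr1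
  have hws : r ≤ B.rhomin * s := by
    rw [hsdef, mul_div_cancel₀ _ hρ.ne']
  have hηarc : Real.sqrt 2 * π * r * s + (w₁ ^ 2 + w₂ ^ 2) ≤ η := by
    have e : Real.sqrt 2 * π * r * s + (w₁ ^ 2 + w₂ ^ 2) = κ₁ * (w₁ ^ 2 + w₂ ^ 2) := by
      rw [hsdef, hκ₁, ← hr2sq]; field_simp
    rw [e]; exact le_of_eq_of_le rfl (by linarith)
  exact klsa_volume_sublevel_le_cooper B hμ (by linarith) (by linarith) hη0 hs0 hs1 hw hws hηarc
    hlam0 hr₀ hr₂ h₀ h₂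

end Main

end Summit.HubbardSuperconductivity.HubbardSuperconductivity.Theorems

end
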